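import Mathlib
import HarnessLib
import Literature.Analysis.FluidPDE.EnstrophySplitting
import Literature.Analysis.FluidPDE.BoundedAnnihilator

/-!
# Item `LrcModEntire` (stmt-NavierStokesRegularity-20428), skeleton twist_split v6 — cell T1 step (I), planar Liouville package, lemma (L1):
# **a `C³` function on `ℝ³` with BOUNDED GRADIENT and CONSTANT LAPLACIAN has constant gradient and zero Laplacian**

Cell ns-regularity-ideate, LEAD ns-poloidal-K2-p3 g13 (`--supports stmt-NavierStokesRegularity-20428`; CELLS-TH-g13 §2ter, item (L1) of the Lean plan for step (I)
of the T1 kill plan).  Pure analysis (the plane version is the `x₂`-independent special case):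

* `harmonicOnNhd_fderiv_apply_of_laplacian_const` — if `Δφ ≡ β` then every directional derivative `y ↦ Dφ(y)a` is harmonic on `ℝ³` (`Δ` commutes with `D` for `C³`
  functions: the tree's `fderiv_laplacian_apply_of_contDiff_three`);
* `fderiv_eq_fderiv_of_laplacian_const_of_bounded` — … so a bounded gradient is CONSTANT (Liouville for bounded harmonic functions, the tree's
  `InnerProductSpace.HarmonicOnNhd.apply_eq_apply_of_abs_le`);
* `laplacian_eq_zero_of_laplacian_const_of_bounded` — … and then `Δφ ≡ 0`, i.e. `β = 0` (the flux argument «`β(2R)² ≤ 8R·sup|∇φ|`» of the dossier, here via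
  Liouville: a constant gradient has zero second derivative).

Used in step (I) for the jets `a⁽ʲ⁾ = ∇φ_j`, `b_{j+2} = −Δφ_j` of a flat thread plane (case «constant jet» and the normalisation `b_{k₀}` constant ⇒ `0`).
WHAT THIS IS NOT: not a claim about Navier–Stokes regularity (bears_on LADDER-NS N0, item 20428 / crux 19708; OPEN).
-/

noncomputable section

-- the summit and its single sub-problem share the name (CONVENTIONS §1), as in every Theorems file
set_option linter.dupNamespace false

namespace Summit.NavierStokesRegularity.NavierStokesRegularity.Theorems.PoloidalWindowDoorLrcModEntireTwistingTHGradientLiouville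

open Set Function Filter Topology InnerProductSpace
open scoped RealInnerProductSpace InnerProductSpace Laplacian ContDiff
open Literature.Analysis Literature.Analysis.FluidPDE

variable {φ : EuclideanSpace ℝ (Fin 3) → ℝ} {β G : ℝ}

/-- **Directional derivatives of a function with constant Laplacian are harmonic.**  `φ ∈ C³(ℝ³)`, `Δφ ≡ β` ⇒ for every `a`, `y ↦ Dφ(y)a` is harmonic on `ℝ³`. -/
theorem harmonicOnNhd_fderiv_apply_of_laplacian_const (hφ : ContDiff ℝ 3 φ) (hβ : ∀ x, (Δ φ) x = β) (a : EuclideanSpace ℝ (Fin 3)) :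
    HarmonicOnNhd (fun y => fderiv ℝ φ y a) univ := by
  intro x _
  have h2 : ContDiff ℝ 2 (fun y => fderiv ℝ φ y a) := (hφ.fderiv_right (m := 2) (by norm_cast)).clm_apply contDiff_const
  refine ⟨h2.contDiffAt, Filter.Eventually.of_forall fun y => ?_⟩
  have hconst : (Δ φ) = fun _ => β := funext hβ
  have h := fderiv_laplacian_apply_of_contDiff_three hφ y a
  rw [hconst] at h
  simp only [fderiv_const_apply, zero_apply] at h
  simpa using h.symm

/-- **Bounded gradient + constant Laplacian ⇒ constant gradient** (Liouville for the bounded harmonic functions `Dφ(·)a`). -/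
theorem fderiv_eq_fderiv_of_laplacian_const_of_bounded (hφ : ContDiff ℝ 3 φ) (hβ : ∀ x, (Δ φ) x = β)
    (hG : ∀ x, ‖fderiv ℝ φ x‖ ≤ G) (x₀ x₁ : EuclideanSpace ℝ (Fin 3)) : fderiv ℝ φ x₀ = fderiv ℝ φ x₁ := by
  ext a
  have hb : ∀ x, |fderiv ℝ φ x a| ≤ G * ‖a‖ := fun x => by
    rw [← Real.norm_eq_abs]
    exact (fderiv ℝ φ x).le_of_opNorm_le (hG x) a
  exact (harmonicOnNhd_fderiv_apply_of_laplacian_const hφ hβ a).apply_eq_apply_of_abs_le hb x₀ x₁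

/-- **… hence the Laplacian vanishes: `β = 0`.**  (`Δφ(x) = Σᵢ D²φ(x)[eᵢ,eᵢ]` and `D²φ = D(Dφ) = 0` for a constant gradient.) -/
theorem laplacian_eq_zero_of_laplacian_const_of_bounded (hφ : ContDiff ℝ 3 φ) (hβ : ∀ x, (Δ φ) x = β)
    (hG : ∀ x, ‖fderiv ℝ φ x‖ ≤ G) : β = 0 := by
  have hconst : fderiv ℝ φ = fun _ => fderiv ℝ φ 0 := funext fun x => fderiv_eq_fderiv_of_laplacian_const_of_bounded hφ hβ hG x 0
  have h2 : iteratedFDeriv ℝ 2 φ 0 = 0 := by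
    ext m
    rw [iteratedFDeriv_two_apply, hconst]
    simp
  have hΔ : (Δ φ) 0 = 0 := by
    rw [laplacian_eq_iteratedFDeriv_stdOrthonormalBasis]
    simp only [h2, zero_apply, Finset.sum_const_zero]
  rw [← hβ 0, hΔ]

/-- **Packaged (L1):** `φ ∈ C³(ℝ³)` with `‖Dφ‖ ≤ G` and `Δφ ≡ β` ⇒ `β = 0` and `Dφ` is constant. -/
theorem gradientLiouville (hφ : ContDiff ℝ 3 φ) (hβ : ∀ x, (Δ φ) x = β) (hG : ∀ x, ‖fderiv ℝ φ x‖ ≤ G) :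
    β = 0 ∧ ∀ x, fderiv ℝ φ x = fderiv ℝ φ 0 :=
  ⟨laplacian_eq_zero_of_laplacian_const_of_bounded hφ hβ hG,
    fun x => fderiv_eq_fderiv_of_laplacian_const_of_bounded hφ hβ hG x 0⟩

end Summit.NavierStokesRegularity.NavierStokesRegularity.Theorems.PoloidalWindowDoorLrcModEntireTwistingTHGradientLiouville
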